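import Literature.MathematicalPhysics.QuantumFieldTheory.WilsonPlaquetteChessboardEvenSide
import Literature.MathematicalPhysics.QuantumFieldTheory.Balaban1983to89.MatrixNorms
import Literature.MathematicalPhysics.QuantumFieldTheory.Balaban1983to89.HaarSmallBallClosedSubgroup
import HarnessLib

/-!
# The single-plaquette LARGE-FIELD TAIL of the Wilson lattice gauge theory at weak coupling:
# `μ_{Λ,β}{‖U_p − 1‖ ≥ θ} ≤ C_G · (1+β)^{d·dim G/2} · e^{−βθ²/2}`, uniformly in the (even) volume

The printed shape is L. Gross's abelian estimate [Gross1983, Thm. 3.6 (3.10) p. 146] «prob_β(h_β(dθ(p)) ≥ c) ≤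
2π(αβd)^{1/2} exp(−βc) for sufficiently large β» for `U(1)` lattice gauge theory in three dimensions, under the FULL
Gibbs law and in every volume (p. 151: «(3.10) can also be deduced … from reflection positivity»).  This file proves
the non-abelian version for the Wilson action `S(U) = Σ_p (N − Re tr ρ(U_p))` of a compact group `G` presented in
`U(N)` by a continuous unitary representation `ρ`, on the torus `(ℤ/Lℤ)^d` of EVERY EVEN side, by the route Gross names:
Osterwalder–Seiler reflection positivity ⇒ the chessboard estimate (tree `PlaquetteChessboard.integral_plaquette_le_rpow_all`,
file `WilsonPlaquetteChessboardEvenSide`) reduces the one-plaquette probability to the `L^d`-th root of the probability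
that ALL `L^d` plaquettes of one plane orientation are large; that probability is at most `Z^{-1} e^{−β L^d θ²/2}`
(`N − Re tr W ≥ ‖W − 1‖²/2` for unitary `W`, tree `MatrixNorms.opDist1_sq_le_card_mul`), and the partition function is
bounded below by restricting the product Haar measure to the ball `{‖ρ(U_e) − 1‖ ≤ r}` on every edge
(`Z ≥ e^{−8Nβr²·#plaquettes} · Haar(ball_r)^{#edges}`, the elementary Laplace lower bound; small balls of `SU(N)`:
tree `HaarSmallBallClosedSubgroup.haar_ball_ge_specialUnitaryGroup`, exponent `N² − 1`).  With `r = (1+β)^{−1/2}` every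
factor is a per-site constant and the `L^d`-th root is VOLUME-INDEPENDENT:

* `measureReal_largePlaquette_le` — general `G`, `ρ`, explicit Haar-ball hypothesis:
  `μ{θ ≤ ‖ρ(U_p) − 1‖} ≤ cb^{−d} · e^{8Nβr²d²} · e^{−βθ²/2}` whenever `cb ≤ Haar{‖ρ g − 1‖ ≤ r}`, `cb > 0`;
* `measureReal_largePlaquette_le_SU` — `G = SU(N)`, fundamental representation:
  `μ{θ ≤ ‖U_p − 1‖} ≤ c^{−d} · e^{8Nd²} · (√(1+β))^{d(N²−1)} · e^{−βθ²/2}` for every plaquette `p`, every `β ≥ 0`,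
  `θ ≥ 0`, every even `L`, with `c = c(N) > 0` the tree's small-ball constant.

This is the height-`0` (bare-plaquette) term of the crux `HistoryTail` of route `UnitScaleTilt` (cell `ym3-torus`, rung
R3; consumer file `Balaban1983to89/T3BarePlaquetteTail`).  Everything here is proved; no `Prop`-valued definitions.

References: L. Gross, *Convergence of U(1)₃ lattice gauge theory to its continuum limit*, Comm. Math. Phys. 92 (1983)
137–162, Thm. 3.6 [Gross1983]; J. Fröhlich, R. Israel, E. H. Lieb, B. Simon, Comm. Math. Phys. 62 (1978) 1–34, Thm. 4.1
[FrohlichIsraelLiebSimon1978]; K. Osterwalder, E. Seiler, Ann. Phys. 110 (1978) 440–471, §2 [OsterwalderSeilerAnnPhys1978].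
-/

noncomputable section

open MeasureTheory Finset Filter Topology
open scoped Matrix.Norms.L2Operator ENNReal

namespace Literature.MathematicalPhysics.QuantumFieldTheory

namespace PlaquetteTail

open PlaquetteChessboard FariaDaVeigaOCarroll2022
open Balaban1983to89.UnitaryModel Balaban1983to89.MatrixNorms

/-! ## §1 The large-field indicator of one plaquette variable -/

section Indicator

variable {m : ℕ} {G : Type*} [Group G] (ρ : G →* Matrix (Fin m) (Fin m) ℂ)

/-- `χ_θ(g) = 1` if `‖ρ(g) − 1‖ ≥ θ`, else `0` (the large-field indicator of [Balaban1985UV3] (7), `1 − χ({|U(∂p)−1| < θ})`).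
[cite: Balaban1985UV3, (7) p.257] -/
def largeInd (θ : ℝ) (g : G) : ℝ := if θ ≤ ‖ρ g - 1‖ then 1 else 0

/-- `0 ≤ χ_θ`. [folklore] -/
private theorem largeInd_nonneg (θ : ℝ) (g : G) : 0 ≤ largeInd ρ θ g := by
  unfold largeInd; split_ifs <;> norm_num

/-- `χ_θ ≤ 1`. [folklore] -/
private theorem largeInd_le_one (θ : ℝ) (g : G) : largeInd ρ θ g ≤ 1 := by
  unfold largeInd; split_ifs <;> norm_num

/-- `|χ_θ| ≤ 1`. [folklore] -/
private theorem abs_largeInd_le_one (θ : ℝ) (g : G) : |largeInd ρ θ g| ≤ 1 := by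
  rw [abs_of_nonneg (largeInd_nonneg ρ θ g)]; exact largeInd_le_one ρ θ g

/-- `χ_θ` is measurable for a continuous representation. [folklore] -/
private theorem measurable_largeInd [TopologicalSpace G] [MeasurableSpace G] [BorelSpace G] (hρc : Continuous ρ) (θ : ℝ) :
    Measurable (largeInd ρ θ) := by
  unfold largeInd
  refine Measurable.ite ?_ measurable_const measurable_const
  exact measurableSet_le measurable_const ((hρc.sub continuous_const).norm).measurable

/-- `χ_θ` is a class function (unitary `ρ`, `m ≠ 0`). [cite: Balaban1985Averaging, (19) p.21] -/
theorem largeInd_conj [NeZero m] (hρu : ∀ g, ρ g ∈ Matrix.unitaryGroup (Fin m) ℂ) (θ : ℝ) (g h : G) :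
    largeInd ρ θ (h * g * h⁻¹) = largeInd ρ θ g := by
  have key : ‖ρ (h * g * h⁻¹) - 1‖ = ‖ρ g - 1‖ := opDist1_map_conj ρ hρu g h
  unfold largeInd; rw [key]

/-- `χ_θ` is invariant under inversion (unitary `ρ`). [folklore] -/
private theorem largeInd_inv (hρu : ∀ g, ρ g ∈ Matrix.unitaryGroup (Fin m) ℂ) (θ : ℝ) (g : G) :
    largeInd ρ θ g⁻¹ = largeInd ρ θ g := by
  have key : ‖ρ g⁻¹ - 1‖ = ‖ρ g - 1‖ := opDist1_map_inv ρ hρu g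
  unfold largeInd; rw [key]

/-- `χ_θ(g) = 1` on the large-field event. [folklore] -/
private theorem largeInd_of_le {θ : ℝ} {g : G} (h : θ ≤ ‖ρ g - 1‖) : largeInd ρ θ g = 1 := by
  unfold largeInd; rw [if_pos h]

/-- `χ_θ(g) = 0` off the large-field event. [folklore] -/
private theorem largeInd_of_not_le {θ : ℝ} {g : G} (h : ¬ θ ≤ ‖ρ g - 1‖) : largeInd ρ θ g = 0 := by
  unfold largeInd; rw [if_neg h]

end Indicator

/-! ## §2 The plaquette term `N − Re tr ρ(W)` of the Wilson action against `‖ρ(W) − 1‖` -/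

section ActionTerm

variable {m : ℕ} [NeZero m] {G : Type*} [Group G] (ρ : G →* Matrix (Fin m) (Fin m) ℂ)
  (hρu : ∀ g, ρ g ∈ Matrix.unitaryGroup (Fin m) ℂ)

omit [NeZero m] in
/-- `Re Tr = N · (Re tr)` (normalised trace of the tree's `UnitaryModel`). [folklore] -/
private theorem trace_re_eq_mul_nReTr [NeZero m] (W : Matrix (Fin m) (Fin m) ℂ) :
    (W.trace).re = (m : ℝ) * nReTr W := by
  have hm : (m : ℝ) ≠ 0 := Nat.cast_ne_zero.mpr (NeZero.ne m)
  rw [nReTr, Fintype.card_fin, mul_div_cancel₀ _ hm]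

include hρu in
/-- `0 ≤ N − Re tr ρ(g)` (unitary `ρ`). [cite: Balaban1987RG1, (0.2) p.252] -/
theorem actionTerm_nonneg (g : G) : 0 ≤ (m : ℝ) - (ρ g).trace.re := by
  rw [trace_re_eq_mul_nReTr]
  have h := nReTr_le_one (hρu g)
  have hm : (0 : ℝ) ≤ m := Nat.cast_nonneg m
  nlinarith

include hρu in
/-- **Large plaquettes cost action**: `‖ρ(g) − 1‖ ≥ θ ≥ 0 ⟹ N − Re tr ρ(g) ≥ θ²/2` (from `|W − 1|² ≤ 2N[1 − Re tr W]`,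
(0.14)). [cite: Balaban1987RG1, (0.14) p.254] -/
theorem half_sq_le_actionTerm {θ : ℝ} (hθ : 0 ≤ θ) {g : G} (h : θ ≤ ‖ρ g - 1‖) :
    θ ^ 2 / 2 ≤ (m : ℝ) - (ρ g).trace.re := by
  haveI : Nonempty (Fin m) := ⟨⟨0, Nat.pos_of_ne_zero (NeZero.ne m)⟩⟩
  have h1 := opDist1_sq_le_card_mul (hρu g)
  rw [Fintype.card_fin] at h1
  have h2 : θ ^ 2 ≤ opDist1 (ρ g) ^ 2 := pow_le_pow_left₀ hθ h 2
  rw [trace_re_eq_mul_nReTr]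
  nlinarith

include hρu in
/-- **Small plaquettes cost little action**: `‖ρ(g) − 1‖ ≤ s ⟹ N − Re tr ρ(g) ≤ N s²/2` (from `2[1 − Re tr W] ≤ |W − 1|²`,
(0.14)). [cite: Balaban1987RG1, (0.14) p.254] -/
theorem actionTerm_le_of_norm_le {s : ℝ} {g : G} (h : ‖ρ g - 1‖ ≤ s) :
    (m : ℝ) - (ρ g).trace.re ≤ (m : ℝ) * s ^ 2 / 2 := by
  haveI : Nonempty (Fin m) := ⟨⟨0, Nat.pos_of_ne_zero (NeZero.ne m)⟩⟩
  have h1 := two_mul_one_sub_nReTr_le_opDist1_sq (hρu g)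
  have h2 : opDist1 (ρ g) ^ 2 ≤ s ^ 2 := pow_le_pow_left₀ (opDist1_nonneg _) h 2
  have hm : (0 : ℝ) ≤ m := Nat.cast_nonneg m
  rw [trace_re_eq_mul_nReTr]
  nlinarith

include hρu in
/-- In the ball `‖ρ(U_e) − 1‖ ≤ r` on the four edges, a plaquette variable satisfies `‖ρ(U_p) − 1‖ ≤ 4r`
(`|UV − 1| ≤ |U − 1| + |V − 1|`, B7 below (19)). [cite: Balaban1985Averaging, (19) p.21] -/
theorem norm_plaquetteHolonomy_sub_one_le {d L : ℕ} {r : ℝ} {U : GaugeConfig d L G} (hU : ∀ e, ‖ρ (U e) - 1‖ ≤ r)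
    (x : Site d L) (i j : Fin d) : ‖ρ (plaquetteHolonomy U x i j) - 1‖ ≤ 4 * r := by
  haveI : Nonempty (Fin m) := ⟨⟨0, Nat.pos_of_ne_zero (NeZero.ne m)⟩⟩
  have hmul := opDist1_map_mul_le ρ hρu
  have hinv := opDist1_map_inv ρ hρu
  unfold plaquetteHolonomy
  have e1 : opDist1 (ρ (U (x, i) * U (x.shift i, j) * (U (x.shift j, i))⁻¹ * (U (x, j))⁻¹)) ≤
      opDist1 (ρ (U (x, i))) + opDist1 (ρ (U (x.shift i, j))) + opDist1 (ρ (U (x.shift j, i))) +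
        opDist1 (ρ (U (x, j))) := by
    calc _ ≤ opDist1 (ρ (U (x, i) * U (x.shift i, j) * (U (x.shift j, i))⁻¹)) + opDist1 (ρ (U (x, j))⁻¹) := hmul _ _
      _ ≤ opDist1 (ρ (U (x, i) * U (x.shift i, j))) + opDist1 (ρ (U (x.shift j, i))⁻¹) + opDist1 (ρ (U (x, j))⁻¹) := by
          gcongr; exact hmul _ _
      _ ≤ opDist1 (ρ (U (x, i))) + opDist1 (ρ (U (x.shift i, j))) + opDist1 (ρ (U (x.shift j, i))⁻¹) +
            opDist1 (ρ (U (x, j))⁻¹) := by gcongr; exact hmul _ _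
      _ = _ := by rw [hinv, hinv]
  have := hU (x, i); have := hU (x.shift i, j); have := hU (x.shift j, i); have := hU (x, j)
  unfold opDist1 at e1
  linarith

end ActionTerm

/-! ## §3 The all-large event, the small ball, and the two Laplace-type bounds on the torus -/

section Torus

variable {d L m : ℕ} [NeZero d] [NeZero L] [NeZero m]
variable {G : Type*} [Group G] [TopologicalSpace G] [IsTopologicalGroup G] [CompactSpace G]
  [MeasurableSpace G] [BorelSpace G]
variable (ρ : G →* Matrix (Fin m) (Fin m) ℂ) (hρu : ∀ g, ρ g ∈ Matrix.unitaryGroup (Fin m) ℂ)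

omit [NeZero d] [NeZero m] in
/-- `#sites = L^d`. [folklore] -/
private theorem card_site : Fintype.card (Site d L) = L ^ d := by
  rw [Fintype.card_fun, ZMod.card, Fintype.card_fin]

omit [NeZero d] [NeZero m] in
/-- `#edges = d · L^d`. [folklore] -/
private theorem card_edge : Fintype.card (Edge d L) = L ^ d * d := by
  rw [Fintype.card_prod, card_site, Fintype.card_fin]

omit [NeZero d] [NeZero m] in
/-- `#plaquettes ≤ d² · L^d`. [folklore] -/
private theorem card_plaquette_le : Fintype.card (Plaquette d L) ≤ L ^ d * d ^ 2 := by
  rw [Fintype.card_prod, card_site]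
  gcongr
  calc Fintype.card {p : Fin d × Fin d // p.1 < p.2} ≤ Fintype.card (Fin d × Fin d) := Fintype.card_subtype_le _
    _ = d ^ 2 := by rw [Fintype.card_prod, Fintype.card_fin, sq]

include hρu in
omit [TopologicalSpace G] [IsTopologicalGroup G] [CompactSpace G] [MeasurableSpace G] [BorelSpace G] in
/-- **On the all-large event the Wilson action is at least `L^d θ²/2`**: if every plaquette of the `(0,a)` plane
orientation (`0 < a`) has `‖ρ(U_p) − 1‖ ≥ θ ≥ 0`, then `S(U) ≥ #sites · θ²/2` (the other plaquette terms are `≥ 0`).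
[cite: Gross1983, Thm. 3.6 (3.10) p.146] -/
theorem card_mul_le_wilsonAction {a : Fin d} (ha : (0 : Fin d) < a) {θ : ℝ} (hθ : 0 ≤ θ) {U : GaugeConfig d L G}
    (hU : ∀ c : Site d L, θ ≤ ‖ρ (plaquetteHolonomy U c 0 a) - 1‖) :
    (Fintype.card (Site d L) : ℝ) * (θ ^ 2 / 2) ≤ wilsonAction ρ U := by
  classical
  unfold wilsonAction
  set ι : Site d L → Plaquette d L := fun c => (c, ⟨((0 : Fin d), a), ha⟩) with hι
  have hinj : Function.Injective ι := fun c c' h => by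
    have := congrArg Prod.fst h; exact this
  calc (Fintype.card (Site d L) : ℝ) * (θ ^ 2 / 2) = ∑ _c : Site d L, θ ^ 2 / 2 := by
        rw [Finset.sum_const, Finset.card_univ, nsmul_eq_mul]
    _ ≤ ∑ c : Site d L, ((m : ℝ) - (ρ (plaquetteHolonomy U (ι c).1 (ι c).2.1.1 (ι c).2.1.2)).trace.re) :=
        Finset.sum_le_sum fun c _ => half_sq_le_actionTerm ρ hρu hθ (hU c)
    _ = ∑ p ∈ (Finset.univ : Finset (Site d L)).image ι,
          ((m : ℝ) - (ρ (plaquetteHolonomy U p.1 p.2.1.1 p.2.1.2)).trace.re) := by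
        rw [Finset.sum_image fun c _ c' _ h => hinj h]
    _ ≤ ∑ p : Plaquette d L, ((m : ℝ) - (ρ (plaquetteHolonomy U p.1 p.2.1.1 p.2.1.2)).trace.re) :=
        Finset.sum_le_sum_of_subset_of_nonneg (Finset.subset_univ _) fun p _ _ => actionTerm_nonneg ρ hρu _

include hρu in
omit [NeZero d] [TopologicalSpace G] [IsTopologicalGroup G] [CompactSpace G] [MeasurableSpace G] [BorelSpace G] in
/-- **In the small ball the Wilson action is at most `8N r² · #plaquettes`.** [cite: Balaban1987RG1, (0.14) p.254] -/
theorem wilsonAction_le_of_ball {r : ℝ} {U : GaugeConfig d L G} (hU : ∀ e, ‖ρ (U e) - 1‖ ≤ r) :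
    wilsonAction ρ U ≤ (Fintype.card (Plaquette d L) : ℝ) * (8 * m * r ^ 2) := by
  unfold wilsonAction
  calc ∑ p : Plaquette d L, ((m : ℝ) - (ρ (plaquetteHolonomy U p.1 p.2.1.1 p.2.1.2)).trace.re)
      ≤ ∑ _p : Plaquette d L, (8 * (m : ℝ) * r ^ 2) := Finset.sum_le_sum fun p _ => by
        have h := actionTerm_le_of_norm_le ρ hρu (norm_plaquetteHolonomy_sub_one_le ρ hρu hU p.1 p.2.1.1 p.2.1.2)
        nlinarith
    _ = _ := by rw [Finset.sum_const, Finset.card_univ, nsmul_eq_mul]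

omit [NeZero d] [NeZero m] in
/-- The product Haar measure of the configurations in the ball on every edge is `Haar(ball)^{#edges}`. [folklore] -/
private theorem pi_ball_eq (r : ℝ) :
    (Measure.pi fun _ : Edge d L => haarProbability G) {U : GaugeConfig d L G | ∀ e, ‖ρ (U e) - 1‖ ≤ r} =
      (haarProbability G {g : G | ‖ρ g - 1‖ ≤ r}) ^ Fintype.card (Edge d L) := by
  have hset : {U : GaugeConfig d L G | ∀ e, ‖ρ (U e) - 1‖ ≤ r} =
      Set.pi Set.univ (fun _ : Edge d L => {g : G | ‖ρ g - 1‖ ≤ r}) := by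
    ext U; simp
  rw [hset, Measure.pi_pi, Finset.prod_const, Finset.card_univ]

include hρu in
omit [NeZero d] in
/-- **Laplace lower bound for the partition function**: for `β ≥ 0` and every `r`,
`∫ e^{−βS} dπ ≥ e^{−8Nβr²·#plaquettes} · Haar{‖ρ g − 1‖ ≤ r}^{#edges}` (restrict the product Haar measure to the ball on
every edge). [cite: Balaban1987RG1, (0.15) p.254] -/
theorem lintegral_boltzmann_ge (hρc : Continuous ρ) {β : ℝ} (hβ : 0 ≤ β) (r : ℝ) :
    ENNReal.ofReal (Real.exp (-(β * ((Fintype.card (Plaquette d L) : ℝ) * (8 * m * r ^ 2))))) *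
        (haarProbability G {g : G | ‖ρ g - 1‖ ≤ r}) ^ Fintype.card (Edge d L) ≤
      ∫⁻ U, ENNReal.ofReal (Real.exp (-β * wilsonAction ρ U)) ∂(Measure.pi fun _ : Edge d L => haarProbability G) := by
  set B : Set (GaugeConfig d L G) := {U | ∀ e, ‖ρ (U e) - 1‖ ≤ r} with hB
  have hBm : MeasurableSet B := by
    have hset : B = Set.pi Set.univ (fun _ : Edge d L => {g : G | ‖ρ g - 1‖ ≤ r}) := by ext U; simp [hB]
    rw [hset]
    exact MeasurableSet.univ_pi fun _ =>
      (isClosed_le ((hρc.sub continuous_const).norm) continuous_const).measurableSet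
  rw [← pi_ball_eq ρ r, ← hB, ← lintegral_indicator_const hBm]
  refine lintegral_mono fun U => ?_
  by_cases hU : U ∈ B
  · rw [Set.indicator_of_mem hU]
    refine ENNReal.ofReal_le_ofReal (Real.exp_le_exp.mpr ?_)
    have h := wilsonAction_le_of_ball ρ hρu (U := U) hU
    nlinarith
  · rw [Set.indicator_of_notMem hU]; exact bot_le

include hρu in
omit [TopologicalSpace G] [IsTopologicalGroup G] [CompactSpace G] [MeasurableSpace G] [BorelSpace G] in
/-- **On the all-large event the Boltzmann weight is tiny**: pointwise
`∏_c χ_θ(U_{(c;0,a)}) · e^{−βS(U)} ≤ e^{−β L^d θ²/2}` (`β, θ ≥ 0`). [cite: Gross1983, Thm. 3.6 (3.10) p.146] -/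
theorem prod_largeInd_mul_boltzmann_le {a : Fin d} (ha : (0 : Fin d) < a) {θ β : ℝ} (hθ : 0 ≤ θ) (hβ : 0 ≤ β)
    (U : GaugeConfig d L G) :
    (∏ c : Site d L, largeInd ρ θ (plaquetteHolonomy U c 0 a)) * Real.exp (-β * wilsonAction ρ U) ≤
      Real.exp (-(β * ((Fintype.card (Site d L) : ℝ) * (θ ^ 2 / 2)))) := by
  by_cases hall : ∀ c : Site d L, θ ≤ ‖ρ (plaquetteHolonomy U c 0 a) - 1‖
  · have h1 : ∏ c : Site d L, largeInd ρ θ (plaquetteHolonomy U c 0 a) = 1 :=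
      Finset.prod_eq_one fun c _ => largeInd_of_le ρ (hall c)
    rw [h1, one_mul]
    refine Real.exp_le_exp.mpr ?_
    have h := card_mul_le_wilsonAction ρ hρu ha hθ hall
    nlinarith
  · simp only [not_forall, not_le] at hall
    obtain ⟨c, hc⟩ := hall
    have h0 : ∏ c : Site d L, largeInd ρ θ (plaquetteHolonomy U c 0 a) = 0 :=
      Finset.prod_eq_zero (Finset.mem_univ c) (largeInd_of_not_le ρ (not_le.mpr hc))
    rw [h0, zero_mul]
    exact (Real.exp_pos _).le

include hρu in
/-- **THE ALL-LARGE PROBABILITY**: for `β, θ ≥ 0`, any `r` and any `cb > 0` with `cb ≤ Haar{‖ρ g − 1‖ ≤ r}`,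
`∫ ∏_c χ_θ(U_{(c;0,a)}) dμ_{Λ,β} ≤ e^{−βL^dθ²/2} / (e^{−8Nβr²·#plaquettes} cb^{#edges})` (numerator bound ÷ partition
function lower bound). [cite: Gross1983, Thm. 3.6 (3.10) p.146] -/
theorem integral_prod_largeInd_le [SecondCountableTopology G] (hρc : Continuous ρ) {β : ℝ} (hβ : 0 ≤ β)
    {a : Fin d} (ha : (0 : Fin d) < a) {θ : ℝ} (hθ : 0 ≤ θ) {r cb : ℝ} (hcb : 0 < cb)
    (hball : ENNReal.ofReal cb ≤ haarProbability G {g : G | ‖ρ g - 1‖ ≤ r}) :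
    ∫ U, ∏ c : Site d L, largeInd ρ θ (plaquetteHolonomy U c 0 a) ∂(wilsonMeasure ρ β) ≤
      Real.exp (-(β * ((Fintype.card (Site d L) : ℝ) * (θ ^ 2 / 2)))) /
        (Real.exp (-(β * ((Fintype.card (Plaquette d L) : ℝ) * (8 * m * r ^ 2)))) * cb ^ Fintype.card (Edge d L)) := by
  set π : Measure (GaugeConfig d L G) := Measure.pi fun _ : Edge d L => haarProbability G with hπ
  set F : GaugeConfig d L G → ℝ := fun U => ∏ c : Site d L, largeInd ρ θ (plaquetteHolonomy U c 0 a) with hF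
  have hFm : Measurable F :=
    Finset.measurable_prod _ fun c _ => (measurable_largeInd ρ hρc θ).comp (measurable_plaquetteHolonomy c 0 a)
  have hF0 : ∀ U, 0 ≤ F U := fun U => Finset.prod_nonneg fun c _ => largeInd_nonneg ρ θ _
  set num : ℝ := Real.exp (-(β * ((Fintype.card (Site d L) : ℝ) * (θ ^ 2 / 2)))) with hnum
  set zlow : ℝ := Real.exp (-(β * ((Fintype.card (Plaquette d L) : ℝ) * (8 * m * r ^ 2)))) *
    cb ^ Fintype.card (Edge d L) with hzlow
  have hzlow_pos : 0 < zlow := mul_pos (Real.exp_pos _) (pow_pos hcb _)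
  have hnum0 : 0 ≤ num := (Real.exp_pos _).le
  -- the expectation as a normalised Lebesgue integral
  have hexp : ∫ U, F U ∂(wilsonMeasure ρ β) = wilsonExpectation ρ β F := rfl
  rw [hexp, wilsonExpectation_eq_toReal_lintegral ρ hρc β hFm hF0]
  -- numerator
  have hN : ∫⁻ U, ENNReal.ofReal (F U) * ENNReal.ofReal (Real.exp (-β * wilsonAction ρ U)) ∂π ≤ ENNReal.ofReal num := by
    calc _ ≤ ∫⁻ _U, ENNReal.ofReal num ∂π := lintegral_mono fun U => by
            rw [← ENNReal.ofReal_mul (hF0 U)]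
            exact ENNReal.ofReal_le_ofReal (prod_largeInd_mul_boltzmann_le ρ hρu ha hθ hβ U)
      _ = ENNReal.ofReal num := by rw [lintegral_const, measure_univ, mul_one]
  -- denominator
  have hZ : ENNReal.ofReal zlow ≤ ∫⁻ U, ENNReal.ofReal (Real.exp (-β * wilsonAction ρ U)) ∂π := by
    refine le_trans ?_ (lintegral_boltzmann_ge ρ hρu hρc hβ r)
    rw [hzlow, ENNReal.ofReal_mul (Real.exp_pos _).le, ENNReal.ofReal_pow hcb.le]
    gcongr
  have hZ0 : (ENNReal.ofReal zlow) ≠ 0 := (ENNReal.ofReal_pos.mpr hzlow_pos).ne'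
  calc ((∫⁻ U, ENNReal.ofReal (Real.exp (-β * wilsonAction ρ U)) ∂π)⁻¹ *
          ∫⁻ U, ENNReal.ofReal (F U) * ENNReal.ofReal (Real.exp (-β * wilsonAction ρ U)) ∂π).toReal
      ≤ ((ENNReal.ofReal zlow)⁻¹ * ENNReal.ofReal num).toReal := by
        refine ENNReal.toReal_mono (ENNReal.mul_ne_top (ENNReal.inv_ne_top.mpr hZ0) ENNReal.ofReal_ne_top) ?_
        exact mul_le_mul' (ENNReal.inv_le_inv.mpr hZ) hN
    _ = num / zlow := by
        rw [ENNReal.toReal_mul, ENNReal.toReal_inv, ENNReal.toReal_ofReal hzlow_pos.le,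
          ENNReal.toReal_ofReal hnum0, div_eq_mul_inv, mul_comm]

/-! ### The single-plaquette tail by the chessboard estimate -/

include hρu in
/-- **THE SINGLE-PLAQUETTE LARGE-FIELD TAIL, general compact group** (`L` even, `β ≥ 0`, `θ ≥ 0`, `0 < a`): if
`0 < cb ≤ Haar{‖ρ g − 1‖ ≤ r}` then
`μ_{Λ,β}{θ ≤ ‖ρ(U_{(c₀;0,a)}) − 1‖} ≤ cb^{−d} · e^{8Nβr²d²} · e^{−βθ²/2}` — chessboard (`integral_plaquette_le_rpow_all`)
applied to `χ_θ`, then the `L^d`-th root of the all-large probability (`integral_prod_largeInd_le`) with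
`#edges = d·L^d`, `#plaquettes ≤ d²·L^d`: every factor is per-site, the bound is volume-independent.
[cite: Gross1983, Thm. 3.6 (3.10) p.146] -/
theorem measureReal_largePlaquette_le_ref [SecondCountableTopology G] (hL : Even L) (hρc : Continuous ρ) {β : ℝ}
    (hβ : 0 ≤ β) {a : Fin d} (ha : (0 : Fin d) < a) {θ : ℝ} (hθ : 0 ≤ θ) {r cb : ℝ} (hcb : 0 < cb)
    (hball : ENNReal.ofReal cb ≤ haarProbability G {g : G | ‖ρ g - 1‖ ≤ r}) (c₀ : Site d L) :
    (wilsonMeasure ρ β).real {U : GaugeConfig d L G | θ ≤ ‖ρ (plaquetteHolonomy U c₀ 0 a) - 1‖} ≤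
      (cb ^ d)⁻¹ * Real.exp (β * (8 * m * r ^ 2) * d ^ 2) * Real.exp (-(β * θ ^ 2 / 2)) := by
  haveI := isProbabilityMeasure_wilsonMeasure (d := d) (L := L) ρ hρc β
  have ha' : a ≠ 0 := ne_of_gt ha
  set μ := wilsonMeasure (d := d) (L := L) ρ β with hμ
  -- the event as the integral of the indicator
  have hmeas : MeasurableSet {U : GaugeConfig d L G | θ ≤ ‖ρ (plaquetteHolonomy U c₀ 0 a) - 1‖} :=
    measurableSet_le measurable_const
      (((hρc.sub continuous_const).norm).measurable.comp (measurable_plaquetteHolonomy c₀ 0 a))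
  have hind : μ.real {U : GaugeConfig d L G | θ ≤ ‖ρ (plaquetteHolonomy U c₀ 0 a) - 1‖} =
      ∫ U, largeInd ρ θ (plaquetteHolonomy U c₀ 0 a) ∂μ := by
    rw [← integral_indicator_one hmeas]
    refine integral_congr_ae (ae_of_all _ fun U => ?_)
    unfold largeInd Set.indicator
    simp only [Set.mem_setOf_eq, Pi.one_apply]
  rw [hind]
  -- chessboard
  have hchess := integral_plaquette_le_rpow_all (L := L) ρ hL hρc hβ ha' (largeInd_nonneg ρ θ)
    ⟨1, abs_largeInd_le_one ρ θ⟩ (measurable_largeInd ρ hρc θ) (largeInd_conj ρ hρu θ) (largeInd_inv ρ hρu θ) c₀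
  refine hchess.trans ?_
  -- the all-large probability and its `L^d`-th root
  have hall := integral_prod_largeInd_le (L := L) ρ hρu hρc hβ ha hθ hcb hball
  have hI0 : 0 ≤ ∫ U, ∏ c : Site d L, largeInd ρ θ (plaquetteHolonomy U c 0 a) ∂μ :=
    integral_nonneg fun U => Finset.prod_nonneg fun c _ => largeInd_nonneg ρ θ _
  set n : ℕ := Fintype.card (Site d L) with hn
  have hnL : ((L : ℝ) ^ d) = (n : ℝ) := by rw [hn, card_site]; push_cast; ring
  have hn0 : 0 < n := Fintype.card_pos
  have hnR : (0 : ℝ) < n := Nat.cast_pos.mpr hn0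
  -- per-site form of the right-hand side: `X ≤ Y^n`
  set Y : ℝ := (cb ^ d)⁻¹ * Real.exp (β * (8 * m * r ^ 2) * d ^ 2) * Real.exp (-(β * θ ^ 2 / 2)) with hY
  have hY0 : 0 ≤ Y := by positivity
  have hE : Fintype.card (Edge d L) = n * d := by rw [hn, card_edge, card_site]
  have hP : (Fintype.card (Plaquette d L) : ℝ) ≤ (n : ℝ) * d ^ 2 := by
    have h : Fintype.card (Plaquette d L) ≤ L ^ d * d ^ 2 := card_plaquette_le
    rw [hn, card_site]; exact_mod_cast h
  have hXY : Real.exp (-(β * ((n : ℝ) * (θ ^ 2 / 2)))) /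
      (Real.exp (-(β * ((Fintype.card (Plaquette d L) : ℝ) * (8 * m * r ^ 2)))) * cb ^ Fintype.card (Edge d L)) ≤
        Y ^ n := by
    rw [hE, hY, mul_pow, mul_pow, ← Real.exp_nat_mul, ← Real.exp_nat_mul, inv_pow, ← pow_mul, mul_comm d n,
      div_eq_mul_inv, mul_inv, ← Real.exp_neg, neg_neg]
    have h1 : Real.exp (-(β * ((n : ℝ) * (θ ^ 2 / 2)))) = Real.exp ((n : ℝ) * -(β * θ ^ 2 / 2)) := by
      congr 1; ring
    have h2 : Real.exp (β * ((Fintype.card (Plaquette d L) : ℝ) * (8 * m * r ^ 2))) ≤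
        Real.exp ((n : ℝ) * (β * (8 * m * r ^ 2) * d ^ 2)) := by
      refine Real.exp_le_exp.mpr ?_
      have h8 : 0 ≤ β * (8 * (m : ℝ) * r ^ 2) := by positivity
      nlinarith
    rw [h1]
    have hcbpos : 0 < (cb ^ (n * d))⁻¹ := by positivity
    calc Real.exp ((n : ℝ) * -(β * θ ^ 2 / 2)) *
          (Real.exp (β * ((Fintype.card (Plaquette d L) : ℝ) * (8 * m * r ^ 2))) * (cb ^ (n * d))⁻¹)
        ≤ Real.exp ((n : ℝ) * -(β * θ ^ 2 / 2)) * (Real.exp ((n : ℝ) * (β * (8 * m * r ^ 2) * d ^ 2)) *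
            (cb ^ (n * d))⁻¹) := by gcongr
      _ = (cb ^ (n * d))⁻¹ * Real.exp ((n : ℝ) * (β * (8 * m * r ^ 2) * d ^ 2)) *
            Real.exp ((n : ℝ) * -(β * θ ^ 2 / 2)) := by ring
  have hroot : (Y ^ n) ^ ((1 : ℝ) / (n : ℝ)) = Y := by
    rw [← Real.rpow_natCast, ← Real.rpow_mul hY0, mul_one_div_cancel hnR.ne', Real.rpow_one]
  calc (∫ U, ∏ c : Site d L, largeInd ρ θ (plaquetteHolonomy U c 0 a) ∂μ) ^ ((1 : ℝ) / (L : ℝ) ^ d)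
      ≤ (Y ^ n) ^ ((1 : ℝ) / (L : ℝ) ^ d) := by
        rw [hnL]
        exact Real.rpow_le_rpow hI0 (hall.trans (by rw [hn] at hXY ⊢; exact hXY)) (by positivity)
    _ = Y := by rw [hnL, hroot]

include hρu in
/-- **THE SINGLE-PLAQUETTE LARGE-FIELD TAIL FOR EVERY PLAQUETTE** (lattice symmetry moves `(x; p, q)` to `(c₀; 0, a)`,
tree `integral_plaquette_eq_of_symmetry`): `μ_{Λ,β}{θ ≤ ‖ρ(U_{(x;p,q)}) − 1‖} ≤ cb^{−d}·e^{8Nβr²d²}·e^{−βθ²/2}` for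
`p ≠ q`, `d ≥ 2`. [cite: Gross1983, Thm. 3.6 (3.10) p.146] -/
theorem measureReal_largePlaquette_le [SecondCountableTopology G] (hL : Even L) (hd : 2 ≤ d) (hρc : Continuous ρ)
    {β : ℝ} (hβ : 0 ≤ β) {θ : ℝ} (hθ : 0 ≤ θ) {r cb : ℝ} (hcb : 0 < cb)
    (hball : ENNReal.ofReal cb ≤ haarProbability G {g : G | ‖ρ g - 1‖ ≤ r}) (x : Site d L) {p q : Fin d}
    (hpq : p ≠ q) :
    (wilsonMeasure ρ β).real {U : GaugeConfig d L G | θ ≤ ‖ρ (plaquetteHolonomy U x p q) - 1‖} ≤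
      (cb ^ d)⁻¹ * Real.exp (β * (8 * m * r ^ 2) * d ^ 2) * Real.exp (-(β * θ ^ 2 / 2)) := by
  haveI := isProbabilityMeasure_wilsonMeasure (d := d) (L := L) ρ hρc β
  set a : Fin d := ⟨1, by omega⟩ with ha_def
  have ha : (0 : Fin d) < a := by rw [ha_def, Fin.lt_def]; simp
  have hmeas : ∀ (y : Site d L) (i j : Fin d),
      MeasurableSet {U : GaugeConfig d L G | θ ≤ ‖ρ (plaquetteHolonomy U y i j) - 1‖} := fun y i j =>
    measurableSet_le measurable_const
      (((hρc.sub continuous_const).norm).measurable.comp (measurable_plaquetteHolonomy y i j))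
  have hind : ∀ (y : Site d L) (i j : Fin d),
      (wilsonMeasure ρ β).real {U : GaugeConfig d L G | θ ≤ ‖ρ (plaquetteHolonomy U y i j) - 1‖} =
        ∫ U, largeInd ρ θ (plaquetteHolonomy U y i j) ∂(wilsonMeasure ρ β) := by
    intro y i j
    rw [← integral_indicator_one (hmeas y i j)]
    refine integral_congr_ae (ae_of_all _ fun U => ?_)
    unfold largeInd Set.indicator
    simp only [Set.mem_setOf_eq, Pi.one_apply]
  rw [hind, integral_plaquette_eq_of_symmetry ρ hρc β (largeInd ρ θ) x x hpq (ne_of_gt ha), ← hind]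
  exact measureReal_largePlaquette_le_ref ρ hρu hL hρc hβ ha hθ hcb hball x

end Torus

/-! ## §4 `G = SU(N)`: the tail with the explicit power `(1+β)^{d(N²−1)/2}` -/

section SpecialUnitary

open Literature.MathematicalPhysics.QuantumLattice (fundamentalRep continuous_fundamentalRep fundamentalRep_mem_unitaryGroup)
open Balaban1983to89.HaarSmallBallClosedSubgroup (haar_ball_ge_specialUnitaryGroup)

variable {d L N : ℕ} [NeZero d] [NeZero L] [NeZero N]

omit [NeZero N] in
/-- `SU(N)` is second countable (a subtype of the second-countable `M_N(ℂ)`). [folklore] -/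
private theorem secondCountable_SU : SecondCountableTopology (Matrix.specialUnitaryGroup (Fin N) ℂ) := by
  haveI := Balaban1983to89.secondCountableTopology_matrix (n := Fin N)
  exact Topology.IsEmbedding.subtypeVal.secondCountableTopology

/-- **THE SINGLE-PLAQUETTE LARGE-FIELD TAIL OF `SU(N)` LATTICE GAUGE THEORY AT WEAK COUPLING, UNIFORM IN THE VOLUME.**
There is `C = C(N, d) > 0` such that on every torus `(ℤ/Lℤ)^d` of even side (`d ≥ 2`), for every `β ≥ 0`, `θ ≥ 0` and
every plaquette `p`: `μ_{Λ,β}{θ ≤ ‖U_p − 1‖} ≤ C · (√(1+β))^{d(N²−1)} · e^{−βθ²/2}` (Wilson action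
`S = Σ_p (N − Re Tr U_p)`; `r = 1/√(1+β)` in `measureReal_largePlaquette_le` and the tree's small-ball bound
`Haar_{SU(N)}{‖V − 1‖ ≤ r} ≥ c·r^{N²−1}`).  The non-abelian, every-volume form of Gross's (3.10).
[cite: Gross1983, Thm. 3.6 (3.10) p.146] -/
theorem exists_measureReal_largePlaquette_le_SU (hd : 2 ≤ d) :
    ∃ C : ℝ, 0 < C ∧ ∀ (L : ℕ) [NeZero L], Even L → ∀ (β : ℝ), 0 ≤ β → ∀ (θ : ℝ), 0 ≤ θ →
      ∀ (x : Site d L) (p q : Fin d), p ≠ q →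
        (wilsonMeasure (fundamentalRep (Fin N)) β).real
            {U : GaugeConfig d L (Matrix.specialUnitaryGroup (Fin N) ℂ) |
              θ ≤ ‖((plaquetteHolonomy U x p q : Matrix.specialUnitaryGroup (Fin N) ℂ) :
                Matrix (Fin N) (Fin N) ℂ) - 1‖} ≤
          C * Real.sqrt (1 + β) ^ (d * (N ^ 2 - 1)) * Real.exp (-(β * θ ^ 2 / 2)) := by
  haveI := secondCountable_SU (N := N)
  obtain ⟨c, hc, -, hball⟩ := haar_ball_ge_specialUnitaryGroup (n := Fin N) (R := 1) one_pos
  refine ⟨(c ^ d)⁻¹ * Real.exp ((8 * N * d ^ 2 : ℝ)), by positivity, ?_⟩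
  intro L _ hL β hβ θ hθ x p q hpq
  -- the radius `r = 1/√(1+β)` and the small-ball constant `cb = c r^{N²−1}`
  set s : ℝ := Real.sqrt (1 + β) with hs
  have hs1 : 1 ≤ s := by rw [hs]; exact Real.one_le_sqrt.mpr (by linarith)
  have hs0 : 0 < s := one_pos.trans_le hs1
  set r : ℝ := s⁻¹ with hr
  have hr0 : 0 < r := inv_pos.mpr hs0
  have hr1 : r ≤ 1 := inv_le_one_of_one_le₀ hs1
  have hβr : β * r ^ 2 ≤ 1 := by
    rw [hr, inv_pow, hs, Real.sq_sqrt (by linarith)]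
    rw [mul_inv_le_iff₀ (by linarith)]; linarith
  haveI : IsProbabilityMeasure (haarProbability (Matrix.specialUnitaryGroup (Fin N) ℂ)) := inferInstance
  haveI : (haarProbability (Matrix.specialUnitaryGroup (Fin N) ℂ)).IsMulLeftInvariant := by
    unfold haarProbability; infer_instance
  have hb := hball (haarProbability (Matrix.specialUnitaryGroup (Fin N) ℂ)) r hr0 hr1
  rw [Fintype.card_fin] at hb
  have hcb : 0 < c * r ^ (N ^ 2 - 1) := mul_pos hc (pow_pos hr0 _)
  have hball' : ENNReal.ofReal (c * r ^ (N ^ 2 - 1)) ≤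
      haarProbability (Matrix.specialUnitaryGroup (Fin N) ℂ)
        {g | ‖fundamentalRep (Fin N) g - 1‖ ≤ r} := by
    simpa only [QuantumLattice.fundamentalRep_apply] using hb
  have key := measureReal_largePlaquette_le (L := L) (fundamentalRep (Fin N)) fundamentalRep_mem_unitaryGroup hL hd
    (continuous_fundamentalRep (Fin N)) hβ hθ hcb hball' x hpq
  simp only [QuantumLattice.fundamentalRep_apply] at key
  refine key.trans ?_
  -- bookkeeping of the constants
  have hexp : Real.exp (β * (8 * (N : ℝ) * r ^ 2) * d ^ 2) ≤ Real.exp (8 * N * d ^ 2) := by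
    refine Real.exp_le_exp.mpr ?_
    have : β * (8 * (N : ℝ) * r ^ 2) * d ^ 2 = (β * r ^ 2) * (8 * N * d ^ 2) := by ring
    rw [this]
    have h8 : (0 : ℝ) ≤ 8 * N * d ^ 2 := by positivity
    nlinarith
  have hpow : ((c * r ^ (N ^ 2 - 1)) ^ d)⁻¹ = (c ^ d)⁻¹ * s ^ (d * (N ^ 2 - 1)) := by
    rw [mul_pow, mul_inv, ← pow_mul, hr, inv_pow, inv_inv, mul_comm (N ^ 2 - 1) d]
  rw [hpow]
  have hpos1 : 0 ≤ (c ^ d)⁻¹ * s ^ (d * (N ^ 2 - 1)) := by positivity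
  calc (c ^ d)⁻¹ * s ^ (d * (N ^ 2 - 1)) * Real.exp (β * (8 * (N : ℝ) * r ^ 2) * d ^ 2) * Real.exp (-(β * θ ^ 2 / 2))
      ≤ (c ^ d)⁻¹ * s ^ (d * (N ^ 2 - 1)) * Real.exp (8 * N * d ^ 2) * Real.exp (-(β * θ ^ 2 / 2)) := by
        gcongr
    _ = (c ^ d)⁻¹ * Real.exp (8 * N * d ^ 2) * s ^ (d * (N ^ 2 - 1)) * Real.exp (-(β * θ ^ 2 / 2)) := by ring

end SpecialUnitary

end PlaquetteTail

end Literature.MathematicalPhysics.QuantumFieldTheory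

end
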